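import Summits.ResolutionOfSingularities.ResolutionOfSingularities.Theorems.PurelyInseparableDim4PointZigzag
import Literature.AlgebraicGeometry.Resolution.NormalCrossingsLocal
import HarnessLib

/-!
# Purely inseparable four-folds: the STEP PACKAGE of the point-centre walk for ZIGZAG charts — every closed order-`p`
# point over the blown-up point is an Edge and carries a zigzag chart (brick TY-3k part 2, cell `res-dim4-pi`)

[OURS · counted 0] (D-0157 DOOR 2; second piece of the FINITE-TREE assembly of `PIDim4.TerminationImpliesOrderReduction`
(typ-3 memo §D (d2)); host item stmt-ResolutionOfSingularities-16155, helper). Nothing here proves resolution of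
singularities in dimension ≥ 4 / characteristic `p`.

ZIGZAG INVARIANT at `(Z, M, x₀)` with state `s`: open immersions `φ : Y ⟶ Z`, `ψ : Y ⟶ 𝔸⁵_K`, a point `y` with
`φ y = x₀` (closed), `ψ y = ξ`, `M.ideal.comap φ = (hypSheaf p s.F).comap ψ`, `mult M = p`, `s.F ≠ 0` clean with
`p ≤ ord₀ s.F`; `K = K̄` of characteristic `p`; `π : W → Z` ANY blowing up of `x₀`.

* `isClosed_singleton_of_isOpenImmersion_eq`, `comap_vanishingIdeal_singleton_of_isOpenImmersion` — the point `y` is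
  closed and BOTH legs pull the point centres back to `𝓘_{y}`: `𝓘_{x₀}·𝒪_Y = 𝓘_y = 𝓘_{ξ}·𝒪_Y`;
* `isBlowup_restrict_comp_isoOpensRange_inv` — over the image of a leg, a blowing up of the point restricts to a
  blowing up of `Y` at `y` (GW Prop. 13.91); hence (`IsBlowup.unique`) the blow-up `π` of `Z` at `x₀` and the chosen
  blow-up `B` of `𝔸⁵_K` at `ξ` are ISOMORPHIC over `Y`: `ε : π⁻¹(φ Y) ≅ B⁻¹(ψ Y)`;
* **`zigzag_step_package`** — for every CLOSED `w ∈ W` over `x₀` with `ord_w M' ≥ p` (`M' = M.transform π 𝓘_{x₀}`):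
  there are `j`, `b` (`b_j = 0`) with an EDGE `Edge p univ s (step p univ j b s)` and a ZIGZAG chart at `(W, M', w)` for
  the next state — transport `w` along `ε` to a closed order-`p` point of `B` over `ξ` (controlled transforms commute
  with the flat `ε`, BGMW Thm. 8.0.5), apply the full-chart `point_step_package` THERE, and pull its chart back along `ε`.

Part 3 (the finite-tree induction) follows. AI-produced formalisation, weaker than expert review.
bears_on: LADDER-RESOLUTION:D157-DOOR2 (res-dim4-pi · TY-3k).
-/

set_option linter.dupNamespace false -- D-0017: single-problem summit path `Summit.<S>.<S>.…` by design

noncomputable section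

universe u

open MvPolynomial Finset CategoryTheory AlgebraicGeometry Opposite TopologicalSpace

namespace Summit.ResolutionOfSingularities.ResolutionOfSingularities.Theorems.PIDim4

open Literature.AlgebraicGeometry.Resolution
open Literature.AlgebraicGeometry.Resolution.Hauser2010
open Literature.AlgebraicGeometry.Resolution.AffinePointBlowup (P A γ coord Wtop ξ)

namespace Equimultiple

/-! ## 1. Both legs of a zigzag chart pull the point centre back to `𝓘_y` -/

section Legs

variable {Z W Y : Scheme.{u}} {π : W ⟶ Z} {x₀ : Z}

/-- The point of an open immersion over a closed point is closed. [folklore] -/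
theorem isClosed_singleton_of_isOpenImmersion_eq (φ : Y ⟶ Z) [IsOpenImmersion φ] (y : Y)
    (hx₀ : IsClosed ({x₀} : Set Z)) (hφ : φ y = x₀) : IsClosed ({y} : Set Y) := by
  have h : (φ : Y → Z) ⁻¹' {x₀} = {y} := by
    ext y'
    simp only [Set.mem_preimage, Set.mem_singleton_iff]
    exact ⟨fun h => φ.isOpenEmbedding.injective (h.trans hφ.symm), fun h => by rw [h, hφ]⟩
  rw [← h]
  exact hx₀.preimage φ.continuous

/-- **`𝓘_{x₀}·𝒪_Y = 𝓘_y`** along an open immersion `φ : Y ⟶ Z` with `φ y = x₀` (the reduced point pulls back to the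
reduced point; tree `comap_vanishingIdeal_of_isOpenImmersion`). [cite: GortzWedhorn2020, Prop. 13.91 (2)] -/
theorem comap_vanishingIdeal_singleton_of_isOpenImmersion (φ : Y ⟶ Z) [IsOpenImmersion φ] (y : Y)
    (hx₀ : IsClosed ({x₀} : Set Z)) (hφ : φ y = x₀) (hy : IsClosed ({y} : Set Y)) :
    (Scheme.IdealSheafData.vanishingIdeal (⟨{x₀}, hx₀⟩ : Closeds Z)).comap φ =
      Scheme.IdealSheafData.vanishingIdeal (⟨{y}, hy⟩ : Closeds Y) := by
  rw [comap_vanishingIdeal_of_isOpenImmersion]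
  congr 1
  apply Closeds.ext
  ext y'
  simp only [Closeds.coe_preimage, Closeds.coe_mk, Set.mem_preimage, Set.mem_singleton_iff]
  exact ⟨fun h => φ.isOpenEmbedding.injective (h.trans hφ.symm), fun h => by rw [h, hφ]⟩

/-- **Over the image of a leg, a blowing up of the point is a blowing up of `Y` at `y`**:
`(π ∣_ φ(Y)) ≫ (Y ≅ φ(Y))⁻¹` is a blowing up of `Y` along `𝓘_y` (GW Prop. 13.91 (1)–(2) for the open immersion, and
transport along the isomorphism `Y ≅ φ(Y)`). [cite: GortzWedhorn2020, Prop. 13.91] -/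
theorem isBlowup_restrict_comp_isoOpensRange_inv (φ : Y ⟶ Z) [IsOpenImmersion φ] (y : Y)
    (hx₀ : IsClosed ({x₀} : Set Z)) (hφ : φ y = x₀) (hy : IsClosed ({y} : Set Y))
    (hπ : IsBlowup π (Scheme.IdealSheafData.vanishingIdeal (⟨{x₀}, hx₀⟩ : Closeds Z))) :
    IsBlowup ((π ∣_ φ.opensRange) ≫ φ.isoOpensRange.inv)
      (Scheme.IdealSheafData.vanishingIdeal (⟨{y}, hy⟩ : Closeds Y)) := by
  have h := (hπ.restrict φ.opensRange).comp_iso φ.isoOpensRange.symm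
  rw [Iso.symm_hom, Iso.symm_inv, ← Scheme.IdealSheafData.comap_comp, Scheme.Hom.isoOpensRange_hom_ι,
    comap_vanishingIdeal_singleton_of_isOpenImmersion φ y hx₀ hφ hy] at h
  exact h

end Legs

/-! ## 2. The zigzag step package -/

section Step

variable {K : Type} [Field K] {p : ℕ} [hp : Fact p.Prime] [CharP K p]
variable {Z W Y : Scheme.{0}} {π : W ⟶ Z} {x₀ : Z}

/-- **THE STEP PACKAGE FOR ZIGZAG CHARTS (point centre, arbitrary ambient).** Under the ZIGZAG INVARIANT at
`(Z, M, x₀)` (module docstring) and for ANY blowing up `π : W → Z` of `x₀`: every CLOSED point `w` of `W` over `x₀`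
at which the transformed marked ideal has order `≥ p` comes from an EDGE `Edge p univ s (step p univ j b s)`
(`b_j = 0`), and the ZIGZAG INVARIANT holds again at `(W, M.transform π 𝓘_{x₀}, w)` with the next state: open
immersions `φ' : Y' ⟶ W`, `ψ' : Y' ⟶ 𝔸⁵_K`, `φ' y' = w`, `ψ' y' = ξ`,
`(M.transform π 𝓘_{x₀}).ideal.comap φ' = (hypSheaf p (step p univ j b s).F).comap ψ'`.
(Transport along the isomorphism `π⁻¹(φ Y) ≅ B⁻¹(ψ Y)` with the chosen blow-up `B` of `𝔸⁵_K` at `ξ`, then the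
full-chart `point_step_package`.) [cite: Hauser2010, §F (equiconstant points)]
[cite: BierstoneGrigorievMilmanWlodarczyk2011, §3.2, Lemma 8.0.3 (2) and Thm. 8.0.5] -/
theorem zigzag_step_package [IsLocallyNoetherian Z] [IsAlgClosed K] [DecidableEq K] (φ : Y ⟶ Z)
    [IsOpenImmersion φ] (ψ : Y ⟶ P 4 K) [IsOpenImmersion ψ] (y : Y) (hx₀ : IsClosed ({x₀} : Set Z))
    (hφ : φ y = x₀) (hψ : ψ y = ξ 4 K) (M : MarkedIdeal Z) (hmult : M.mult = p) (s : State K)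
    (hM : M.ideal.comap φ = (hypSheaf p s.F).comap ψ) (hF : s.F ≠ 0)
    (hclean : Literature.Barriers.ResolutionOfSingularities.HauserPerlega.IsClean p s.F)
    (hperm : (p : ℕ∞) ≤ CentreBlowup.ordAlong (Finset.univ : Finset (Fin 4)) s.F)
    (hπ : IsBlowup π (Scheme.IdealSheafData.vanishingIdeal (⟨{x₀}, hx₀⟩ : Closeds Z))) {w : W}
    (hw : IsClosed ({w} : Set W)) (hwx : π w = x₀)
    (hord : (p : ℕ∞) ≤ idealOrder
      (M.transform π (Scheme.IdealSheafData.vanishingIdeal (⟨{x₀}, hx₀⟩ : Closeds Z))).ideal w) :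
    ∃ (j : Fin 4) (b : Fin 4 → K), b j = 0 ∧ Edge p Finset.univ s (CentreBlowup.step p Finset.univ j b s) ∧
      ∃ (Y' : Scheme.{0}) (φ' : Y' ⟶ W) (ψ' : Y' ⟶ P 4 K) (_ : IsOpenImmersion φ') (_ : IsOpenImmersion ψ')
        (y' : Y'), φ' y' = w ∧ ψ' y' = ξ 4 K ∧
        (M.transform π (Scheme.IdealSheafData.vanishingIdeal (⟨{x₀}, hx₀⟩ : Closeds Z))).ideal.comap φ' =
          (hypSheaf p (CentreBlowup.step p Finset.univ j b s).F).comap ψ' := by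
  haveI : IsProper π := hπ.isProper
  haveI : IsLocallyNoetherian W := LocallyOfFiniteType.isLocallyNoetherian π
  -- notation: the two centres, the chosen blow-up `B` of `𝔸⁵_K` at `ξ`, the legs' images and isomorphisms
  set C := Scheme.IdealSheafData.vanishingIdeal (⟨{x₀}, hx₀⟩ : Closeds Z) with hC
  have hξc : IsClosed ({ξ 4 K} : Set (P 4 K)) := AffinePointBlowup.isClosed_ξ 4 K
  set C₀ := Scheme.IdealSheafData.vanishingIdeal (⟨{ξ 4 K}, hξc⟩ : Closeds (P 4 K)) with hC₀
  set B := blowup.π C₀ with hBdef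
  have hB : IsBlowup B C₀ := blowup.isBlowup C₀
  haveI : IsProper B := hB.isProper
  haveI : IsLocallyNoetherian (blowup C₀) := LocallyOfFiniteType.isLocallyNoetherian B
  haveI : JacobsonSpace (blowup C₀) := jacobsonSpace_of_isBlowup' hB
  set M₀ : MarkedIdeal (P 4 K) := ⟨hypSheaf p s.F, [], p⟩ with hM₀
  have hy : IsClosed ({y} : Set Y) := isClosed_singleton_of_isOpenImmersion_eq φ y hx₀ hφ
  set Cy := Scheme.IdealSheafData.vanishingIdeal (⟨{y}, hy⟩ : Closeds Y) with hCy
  set V : Z.Opens := φ.opensRange with hV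
  set U : (P 4 K).Opens := ψ.opensRange with hU
  set e₁ : Y ≅ (V : Scheme.{0}) := φ.isoOpensRange with he₁
  set e₂ : Y ≅ (U : Scheme.{0}) := ψ.isoOpensRange with he₂
  have he₁ι : e₁.hom ≫ V.ι = φ := Scheme.Hom.isoOpensRange_hom_ι φ
  have he₂ι : e₂.hom ≫ U.ι = ψ := Scheme.Hom.isoOpensRange_hom_ι ψ
  -- the centres and the ideals, moved to `V` and `U`
  have hCV : (C.comap V.ι).comap e₁.hom = Cy := by
    rw [← Scheme.IdealSheafData.comap_comp, he₁ι]
    exact comap_vanishingIdeal_singleton_of_isOpenImmersion φ y hx₀ hφ hy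
  have hCU : (C₀.comap U.ι).comap e₂.hom = Cy := by
    rw [← Scheme.IdealSheafData.comap_comp, he₂ι]
    exact comap_vanishingIdeal_singleton_of_isOpenImmersion ψ y hξc hψ hy
  have hIV : (M.ideal.comap V.ι).comap e₁.hom = (hypSheaf p s.F).comap ψ := by
    rw [← Scheme.IdealSheafData.comap_comp, he₁ι]
    exact hM
  have hIU : (M₀.ideal.comap U.ι).comap e₂.hom = (hypSheaf p s.F).comap ψ := by
    rw [← Scheme.IdealSheafData.comap_comp, he₂ι]
  -- (A) both restricted blow-ups are blow-ups of `Y` at `y`; they are isomorphic over `Y`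
  have hπY : IsBlowup ((π ∣_ V) ≫ e₁.inv) Cy :=
    isBlowup_restrict_comp_isoOpensRange_inv φ y hx₀ hφ hy hπ
  have hBY : IsBlowup ((B ∣_ U) ≫ e₂.inv) Cy :=
    isBlowup_restrict_comp_isoOpensRange_inv ψ y hξc hψ hy hB
  obtain ⟨ε, hε, -⟩ := hπY.unique hBY
  have hsq : ε.hom ≫ (B ∣_ U) = (π ∣_ V) ≫ (e₁.inv ≫ e₂.hom) := by
    calc ε.hom ≫ (B ∣_ U) = (ε.hom ≫ ((B ∣_ U) ≫ e₂.inv)) ≫ e₂.hom := by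
          simp only [Category.assoc, Iso.inv_hom_id, Category.comp_id]
      _ = ((π ∣_ V) ≫ e₁.inv) ≫ e₂.hom := by rw [hε]
      _ = (π ∣_ V) ≫ (e₁.inv ≫ e₂.hom) := by simp only [Category.assoc]
  -- (KEY) the two transformed ideals correspond under `ε`
  have hC' : (C₀.comap U.ι).comap (e₁.inv ≫ e₂.hom) = C.comap V.ι := by
    rw [Scheme.IdealSheafData.comap_comp, hCU, ← hCV, ← Scheme.IdealSheafData.comap_comp, Iso.inv_hom_id,
      Scheme.IdealSheafData.comap_id]
  have hI' : (M₀.ideal.comap U.ι).comap (e₁.inv ≫ e₂.hom) = M.ideal.comap V.ι := by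
    rw [Scheme.IdealSheafData.comap_comp, hIU, ← hIV, ← Scheme.IdealSheafData.comap_comp, Iso.inv_hom_id,
      Scheme.IdealSheafData.comap_id]
  have hKEY : ((M₀.transform B C₀).ideal.comap (B ⁻¹ᵁ U).ι).comap ε.hom =
      (M.transform π C).ideal.comap (π ⁻¹ᵁ V).ι := by
    rw [MarkedIdeal.transform_ideal, MarkedIdeal.transform_ideal, ← controlledTransform_morphismRestrict,
      ← controlledTransform_morphismRestrict, hmult,
      comap_controlledTransform_of_flat (s := ε.hom) (π := B ∣_ U) (π' := π ∣_ V) (e₁.inv ≫ e₂.hom) hsq, hC', hI']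
  -- (B) the point `w`, seen in `π⁻¹ V`, in `B⁻¹ U`, and in `Bl`
  have hx₀V : x₀ ∈ V := by
    rw [← hφ, ← he₁ι, Scheme.Hom.comp_apply]
    exact (e₁.hom y).2
  have hwV : w ∈ π ⁻¹ᵁ V := by
    change π w ∈ V
    rw [hwx]
    exact hx₀V
  set wt : (π ⁻¹ᵁ V : Scheme.{0}) := ⟨w, hwV⟩ with hwt
  have hιwt : (π ⁻¹ᵁ V).ι wt = w := rfl
  have hwt_closed : IsClosed ({wt} : Set (π ⁻¹ᵁ V : Scheme.{0})) :=
    isClosed_singleton_of_isOpenImmersion_eq (π ⁻¹ᵁ V).ι wt hw hιwt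
  have hεwt_closed : IsClosed ({ε.hom wt} : Set (B ⁻¹ᵁ U : Scheme.{0})) := by
    have h : (ε.inv : (B ⁻¹ᵁ U : Scheme.{0}) → (π ⁻¹ᵁ V : Scheme.{0})) ⁻¹' {wt} = {ε.hom wt} := by
      ext z
      simp only [Set.mem_preimage, Set.mem_singleton_iff]
      constructor
      · intro hz
        rw [← hz, ← Scheme.Hom.comp_apply, Iso.inv_hom_id]
        rfl
      · intro hz
        rw [hz, ← Scheme.Hom.comp_apply, Iso.hom_inv_id]
        rfl
    rw [← h]
    exact hwt_closed.preimage ε.inv.continuous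
  set w' : blowup C₀ := (B ⁻¹ᵁ U).ι (ε.hom wt) with hw'
  have hw'_closed : IsClosed ({w'} : Set (blowup C₀)) := by
    apply isClosed_singleton_of_isLocallyClosed_singleton
    rw [hw', ← Set.image_singleton]
    exact hεwt_closed.isLocallyClosed.image (B ⁻¹ᵁ U).ι.isOpenEmbedding.isInducing
      (B ⁻¹ᵁ U).ι.isOpenEmbedding.isOpen_range.isLocallyClosed
  -- `(π ∣_ V) wt = e₁ y`, hence `B w' = ξ`
  have hπwt : (π ∣_ V) wt = e₁.hom y := by
    apply Subtype.ext
    rw [morphismRestrict_base_coe]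
    change π w = ((e₁.hom ≫ V.ι) y : Z)
    rw [he₁ι, hφ, hwx]
  have he₁y : e₁.inv (e₁.hom y) = y := by
    rw [← Scheme.Hom.comp_apply, Iso.hom_inv_id]
    rfl
  have hBw' : B w' = ξ 4 K := by
    rw [hw', ← ι_morphismRestrict_apply, ← Scheme.Hom.comp_apply ε.hom (B ∣_ U), hsq, Scheme.Hom.comp_apply,
      Scheme.Hom.comp_apply, hπwt, he₁y, ← Scheme.Hom.comp_apply, he₂ι, hψ]
  -- the order at `w'` is the order at `w`
  have hord' : (p : ℕ∞) ≤ idealOrder (M₀.transform B C₀).ideal w' := by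
    have h := hord
    rw [← hιwt, ← idealOrder_comap_of_isOpenImmersion (π ⁻¹ᵁ V).ι, ← hKEY,
      idealOrder_comap_of_isOpenImmersion ε.hom, idealOrder_comap_of_isOpenImmersion (B ⁻¹ᵁ U).ι] at h
    exact h
  -- (C) the full-chart step package on `𝔸⁵_K` at `w'`
  obtain ⟨j, b, hbj, hedge, φ₀, _, hφ₀, hM₀'⟩ :=
    point_step_package (𝟙 (P 4 K)) hξc rfl M₀ rfl s (Scheme.IdealSheafData.comap_id _) hF hclean hperm hB
      hw'_closed hBw' hord'
  refine ⟨j, b, hbj, hedge, ?_⟩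
  -- (D) pull the chart back along `ε`
  have hξY' : ξ 4 K ∈ φ₀ ⁻¹ᵁ (B ⁻¹ᵁ U) := by
    change φ₀ (ξ 4 K) ∈ B ⁻¹ᵁ U
    rw [hφ₀, hw']
    exact (ε.hom wt).2
  refine ⟨(φ₀ ⁻¹ᵁ (B ⁻¹ᵁ U) : (P 4 K).Opens), (φ₀ ∣_ (B ⁻¹ᵁ U)) ≫ ε.inv ≫ (π ⁻¹ᵁ V).ι,
    (φ₀ ⁻¹ᵁ (B ⁻¹ᵁ U)).ι, inferInstance, inferInstance, ⟨ξ 4 K, hξY'⟩, ?_, rfl, ?_⟩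
  · have h1 : (φ₀ ∣_ (B ⁻¹ᵁ U)) ⟨ξ 4 K, hξY'⟩ = ε.hom wt := by
      apply Subtype.ext
      rw [morphismRestrict_base_coe]
      exact hφ₀
    have h2 : ε.inv (ε.hom wt) = wt := by
      rw [← Scheme.Hom.comp_apply, Iso.hom_inv_id]
      rfl
    rw [Scheme.Hom.comp_apply, Scheme.Hom.comp_apply, h1, h2]
    rfl
  · rw [Scheme.IdealSheafData.comap_comp, Scheme.IdealSheafData.comap_comp, ← hKEY,
      ← Scheme.IdealSheafData.comap_comp _ ε.inv ε.hom, Iso.inv_hom_id, Scheme.IdealSheafData.comap_id,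
      ← Scheme.IdealSheafData.comap_comp, morphismRestrict_ι, Scheme.IdealSheafData.comap_comp, hM₀']

end Step

end Equimultiple

end Summit.ResolutionOfSingularities.ResolutionOfSingularities.Theorems.PIDim4

end
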